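import Literature.AlgebraicGeometry.AbelianSchemes.HomFactorsThroughMulNLocus
import Literature.AlgebraicGeometry.AbelianSchemes.AbelianSchemeOverMulNEtale
import Literature.AlgebraicGeometry.AbelianSchemes.AbelianSchemeOverZariskiGluingLevel
import HarnessLib

/-!
# A homomorphism of abelian schemes kills the `N`-torsion as soon as it does so over a nilpotent thickening of the base;
# hence «division by `[N]`» along a thickening ([MumfordFogartyKirwan1994] Ch. 6 §2, proof of Prop. 6.11; [SGA1] I Cor. 5.6)

Layer `Literature/AlgebraicGeometry/AbelianSchemes`, namespace `Literature.AlgebraicGeometry.AbelianSchemes.AbelianSchemeOver`.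
THEOREMS ONLY (no definition, no named fact, no instance, no notation, no `sorry`).  Cell `hodgecm-mathlib` (D-0151 / D-0183
FLOOR 0), programme P1 sub-line F-11 «`𝒜_{g,δ,N} → Spec ℚ` is smooth» (crux workfile `Cruxes/HDel/Lines/F11SmoothRoadA.lean`,
stub `stub_polarizedLift`, v1 cut α, piece **α3** «`Λ(L) = 2λ` with `λ` lifting `λ₀`»; B-p05 (g19)).  Count-neutral capital; HC_CM
is proved only modulo the 7 printed citations until rung 0 closes, and nothing here is about HC.

THE PRINT.  [MumfordFogartyKirwan1994] p. 122 (proof of Prop. 6.11): whether a homomorphism `φ : X → Y` of abelian schemes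
«is of the form `μ ∘ ψ_N`» is decided on the finite flat group scheme `ker ψ_N = X[N]`: `μ` exists iff `φ ∘ I = ε ∘ π` on
`X[N]` (★ `existsUnique_pow_id_comp_eq_of_forall_pow_eq_one`, the point-wise form «`t ^ N = 1 → t ≫ φ = 1`»).  When `N` is
invertible on the base, `X[N]` and `Y[N]` are finite ÉTALE over `S` (★ `etale_fst_unit_pow_id`, [BLRNeronModels1990] §7.3
Lemma 2 (b)), and a morphism into an étale `S`-scheme is determined by its restriction to any closed subscheme with the same
underlying space ([SGA1] Exp. I Cor. 5.6 «prolongement des relèvements», ★ `FundamentalGroup.existsUnique_lift_of_etale`).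
Consequently the condition «`φ` kills `X[N]`» can be tested after base change to a nilpotent thickening `S₀ ↪ S`: this is
the step of the infinitesimal lifting of polarisations ([Oort1971] §2; [Lan2013PELCompactifications] §2.2.4) where one passes
from a lift of `2λ₀ = Λ(L^Δ(λ₀))` to a lift of `λ₀` itself.

* §1 `comp_eq_one_of_forall_pow_eq_one_of_isBaseChangeVia_of_surjective` — for a surjective closed immersion `i : S₀ → S`,
  `N` invertible on `S`, a base-change square `G : A₀ → A` over `i` of group schemes (★ `IsBaseChangeVia`), and a homomorphism
  `φ : A → B` of abelian schemes over `S`: if every `N`-torsion point of `A₀` (over any `S₀`-scheme) goes to `1` under `G ≫ φ`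
  (`hG.pushHom t₀ ≫ φ = 1`), then every `N`-torsion point of `A` (over any `S`-scheme) goes to `1` under `φ`.
* §2 `exists_isMonHom_pow_id_comp_eq_of_isBaseChangeVia_of_surjective` — hence `φ = [N] ≫ ψ` for a unique homomorphism `ψ`
  (★ `exists_isMonHom_pow_id_comp_eq_of_forall_pow_eq_one`, [MumfordAV1970] §7 Thm. 4).

## References
* [MumfordFogartyKirwan1994] D. Mumford, J. Fogarty, F. Kirwan, *Geometric Invariant Theory*, 3rd ed. (1994), Ch. 6 §2
  Prop. 6.11 and its proof (pp. 122–123), Lemma 6.12 (p. 122).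
* [SGA1] A. Grothendieck, *SGA 1* (LNM 224), Exp. I Cor. 5.6 (p. 8).
* [MumfordAV1970] D. Mumford, *Abelian Varieties* (1970), §7 Thm. 4 (p. 72).
* [BLRNeronModels1990] S. Bosch, W. Lütkebohmert, M. Raynaud, *Néron Models* (1990), §7.3 Lemma 2 (b) (p. 180).
* [Oort1971] F. Oort, *Finite group schemes, local moduli for abelian varieties, and lifting problems*, Compos. Math. 23
  (1971), §2.
-/

set_option backward.isDefEq.respectTransparency false

noncomputable section

open CategoryTheory CategoryTheory.Limits AlgebraicGeometry MonoidalCategory CartesianMonoidalCategory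
open scoped MonObj

universe u

namespace Literature.AlgebraicGeometry.AbelianSchemes

namespace AbelianSchemeOver

variable {S₀ S : Scheme.{u}} {i : S₀ ⟶ S} [IsClosedImmersion i] [Surjective i]
  (A : AbelianSchemeOver S) {B : AbelianSchemeOver S} (φ : A.X ⟶ B.X) [IsMonHom φ] {N : ℕ}
  {A₀ : AbelianSchemeOver S₀} {G : A₀.X.left ⟶ A.X.left}

/-! ## §1 Killing the `N`-torsion is detected over a nilpotent thickening of the base -/

/-- **A homomorphism of abelian schemes kills the `N`-torsion as soon as it does so over a surjective closed subscheme of the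
base** (`N` invertible on `S`).  Let `i : S₀ → S` be a surjective closed immersion, `G : A₀ → A` over `i` a base-change square
of group schemes (★ `IsBaseChangeVia`), `φ : A → B` a homomorphism of abelian schemes over `S`, and suppose `t₀ ≫ G ≫ φ = 1`
for every `N`-torsion point `t₀` of `A₀` with values in an `S₀`-scheme (`hG.pushHom t₀ ≫ φ = 1`).  Then `t ≫ φ = 1` for every
`N`-torsion point `t` of `A` with values in an `S`-scheme.  Proof: test on the universal `N`-torsion point `ι : A[N] → A`;
`ι ≫ φ` factors through `B[N]`, which is ÉTALE over `S` (★ `etale_fst_unit_pow_id`), and it agrees with the unit after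
restriction to `A[N] ×_S S₀ ↪ A[N]` (a surjective closed immersion) by hypothesis — so it IS the unit by the uniqueness of
liftings along nilpotent immersions into étale schemes ([SGA1] I Cor. 5.6, ★ `FundamentalGroup.existsUnique_lift_of_etale`).
[cite: SGA1, Exp. I Cor. 5.6 (p. 8)] [cite: MumfordFogartyKirwan1994, Ch. 6 §2 Prop. 6.11 (p. 122; proof pp. 122–123)]
[cite: BLRNeronModels1990, §7.3 Lemma 2 (b) (p. 180)] -/
theorem comp_eq_one_of_forall_pow_eq_one_of_isBaseChangeVia_of_surjective
    (hN : ∀ s : S, (N : S.residueField s) ≠ 0) (hG : A₀.IsBaseChangeVia A i G)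
    (h₀ : ∀ ⦃T₀ : Over S₀⦄ (t₀ : T₀ ⟶ A₀.X), t₀ ^ N = 1 → hG.pushHom t₀ ≫ φ = 1)
    ⦃T : Over S⦄ (t : T ⟶ A.X) (ht : t ^ N = 1) : t ≫ φ = 1 := by
  -- `[N]` on `A` and on `B`, on underlying schemes
  set nA : A.X.left ⟶ A.X.left := (((𝟙 A.X : A.X ⟶ A.X) ^ N : A.X ⟶ A.X)).left with hnA
  set nB : B.X.left ⟶ B.X.left := (((𝟙 B.X : B.X ⟶ B.X) ^ N : B.X ⟶ B.X)).left with hnB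
  -- `η.left ≫ [N].left = η.left` (the unit is `N`-torsion)
  have hηA : (η[A.X] : 𝟙_ (Over S) ⟶ A.X).left ≫ nA = (η[A.X] : 𝟙_ (Over S) ⟶ A.X).left := by
    have h1 : ((1 : 𝟙_ (Over S) ⟶ A.X) ^ N) = 1 := one_pow N
    have h2 := (A.pow_eq_one_iff_left (1 : 𝟙_ (Over S) ⟶ A.X) N).1 h1
    rw [A.one_left_eq_hom_comp_unitSection] at h2
    rw [MonObj.one_eq_one]
    rw [A.one_left_eq_hom_comp_unitSection]
    exact h2
  have hηB : (η[B.X] : 𝟙_ (Over S) ⟶ B.X).left ≫ nB = (η[B.X] : 𝟙_ (Over S) ⟶ B.X).left := by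
    have h1 : ((1 : 𝟙_ (Over S) ⟶ B.X) ^ N) = 1 := one_pow N
    have h2 := (B.pow_eq_one_iff_left (1 : 𝟙_ (Over S) ⟶ B.X) N).1 h1
    rw [B.one_left_eq_hom_comp_unitSection] at h2
    rw [MonObj.one_eq_one]
    rw [B.one_left_eq_hom_comp_unitSection]
    exact h2
  -- the `N`-torsion schemes `A[N] = S ×_{η, A, [N]} A`, `B[N]`
  let PA := pullback (η[A.X] : 𝟙_ (Over S) ⟶ A.X).left nA
  let PB := pullback (η[B.X] : 𝟙_ (Over S) ⟶ B.X).left nB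
  let pA : PA ⟶ S := pullback.fst (η[A.X] : 𝟙_ (Over S) ⟶ A.X).left nA
  let pB : PB ⟶ S := pullback.fst (η[B.X] : 𝟙_ (Over S) ⟶ B.X).left nB
  haveI : Etale pB := B.etale_fst_unit_pow_id hN
  -- `A[N]` as an `S`-scheme and its universal point `tN`
  let TN : Over S := Over.mk pA
  have htNw : pullback.snd (η[A.X] : 𝟙_ (Over S) ⟶ A.X).left nA ≫ A.X.hom = pA := by
    have hc := pullback.condition (f := (η[A.X] : 𝟙_ (Over S) ⟶ A.X).left) (g := nA)
    have hn : nA ≫ A.X.hom = A.X.hom := Over.w _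
    have hu : (η[A.X] : 𝟙_ (Over S) ⟶ A.X).left ≫ A.X.hom = 𝟙 S := Over.w _
    rw [← Category.comp_id pA]
    change _ = pullback.fst _ _ ≫ 𝟙 S
    rw [← hu, ← Category.assoc, hc, Category.assoc, hn]
  let tN : TN ⟶ A.X := Over.homMk (pullback.snd (η[A.X] : 𝟙_ (Over S) ⟶ A.X).left nA) htNw
  have htNN : tN ^ N = 1 := by
    rw [A.pow_eq_one_iff_left]
    change pullback.snd _ _ ≫ nA = pA ≫ (η[A.X] : 𝟙_ (Over S) ⟶ A.X).left
    exact pullback.condition.symm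
  -- `u := tN ≫ φ` is `N`-torsion, hence a point of `B[N]`
  have huN : (tN ≫ φ) ^ N = 1 := by rw [← MonObj.pow_comp, htNN, MonObj.one_comp]
  have huL : (tN ≫ φ).left ≫ nB = pA ≫ (η[B.X] : 𝟙_ (Over S) ⟶ B.X).left := (B.pow_eq_one_iff_left (tN ≫ φ) N).1 huN
  let ubar : PA ⟶ PB := pullback.lift pA (tN ≫ φ).left huL.symm
  let obar : PA ⟶ PB := pullback.lift pA (pA ≫ (η[B.X] : 𝟙_ (Over S) ⟶ B.X).left)
    (by rw [Category.assoc, hηB])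
  -- the thickening `A[N] ×_S S₀ ↪ A[N]`
  let j : pullback pA i ⟶ PA := pullback.fst pA i
  -- `tN ≫ φ` is trivial over `S₀`: by hypothesis, through `pushHom`
  have hj : j ≫ (tN ≫ φ).left = j ≫ pA ≫ (η[B.X] : 𝟙_ (Over S) ⟶ B.X).left := by
    -- the point `j ≫ tN` of `A` lies over `S₀ → S`
    let T₀ : Over S₀ := Over.mk (pullback.snd pA i)
    have hw : (j ≫ pullback.snd (η[A.X] : 𝟙_ (Over S) ⟶ A.X).left nA) ≫ A.X.hom = T₀.hom ≫ i := by
      rw [Category.assoc, htNw]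
      exact pullback.condition
    let q : Over.mk (T₀.hom ≫ i) ⟶ A.X := Over.homMk (j ≫ pullback.snd (η[A.X] : 𝟙_ (Over S) ⟶ A.X).left nA) hw
    have hqN : q ^ N = 1 := by
      rw [A.pow_eq_one_iff_left]
      change (j ≫ pullback.snd _ _) ≫ nA = (T₀.hom ≫ i) ≫ A.unitSection
      rw [Category.assoc, ← pullback.condition, ← Category.assoc]
      congr 1
      exact pullback.condition
    -- pull `q` back to a point `t₀` of `A₀` through the cartesian square
    let t₀ : T₀ ⟶ A₀.X := (hG.pushHomMulEquiv T₀).symm q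
    have ht₀q : hG.pushHom t₀ = q := (hG.pushHomMulEquiv T₀).apply_symm_apply q
    have ht₀N : t₀ ^ N = 1 := by
      apply (hG.pushHomMulEquiv T₀).injective
      rw [map_pow, map_one, IsBaseChangeVia.pushHomMulEquiv_apply, ht₀q, hqN]
    have hq1 : q ≫ φ = 1 := by rw [← ht₀q]; exact h₀ t₀ ht₀N
    have hq1' := (A.comp_eq_one_iff_left q φ).1 hq1
    -- read on underlying schemes
    change j ≫ (pullback.snd _ _ ≫ φ.left) = _
    rw [← Category.assoc]
    change q.left ≫ φ.left = _
    rw [hq1']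
    change (T₀.hom ≫ i) ≫ B.unitSection = j ≫ pA ≫ _
    rw [← Category.assoc]
    congr 1
    exact pullback.condition.symm
  -- both `ubar` and `obar` lift `j ≫ ubar` along `j` over the ÉTALE `B[N] → S`; hence they coincide
  have hlift : j ≫ ubar = j ≫ obar := by
    apply pullback.hom_ext
    · rw [Category.assoc, Category.assoc, pullback.lift_fst, pullback.lift_fst]
    · rw [Category.assoc, Category.assoc, pullback.lift_snd, pullback.lift_snd, hj]
  have heq : ubar = obar := by
    obtain ⟨g, -, huniq⟩ :=
      Literature.AlgebraicGeometry.FundamentalGroup.existsUnique_lift_of_etale pB j (j ≫ ubar) pA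
        (by rw [Category.assoc, pullback.lift_fst])
    have h1 : ubar = g := huniq ubar ⟨rfl, pullback.lift_fst _ _ _⟩
    have h2 : obar = g := huniq obar ⟨hlift.symm, pullback.lift_fst _ _ _⟩
    rw [h1, h2]
  have htN1 : tN ≫ φ = 1 := by
    rw [A.comp_eq_one_iff_left]
    change (tN ≫ φ).left = pA ≫ B.unitSection
    have h := congrArg (· ≫ pullback.snd (η[B.X] : 𝟙_ (Over S) ⟶ B.X).left nB) heq
    simp only [ubar, obar, pullback.lift_snd] at h
    exact h
  -- finally: every `N`-torsion point `t` factors through `tN`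
  have htL := (A.pow_eq_one_iff_left t N).1 ht
  let k : T.left ⟶ PA := pullback.lift T.hom t.left (by rw [htL])
  let κ : T ⟶ TN := Over.homMk k (pullback.lift_fst _ _ _)
  have hκ : κ ≫ tN = t := by
    ext
    change k ≫ pullback.snd _ _ = t.left
    exact pullback.lift_snd _ _ _
  rw [← hκ, Category.assoc, htN1, MonObj.comp_one]

/-! ## §2 Division by `[N]` along a thickening -/

/-- **Division by `[N]` is detected over a nilpotent thickening of the base.**  In the situation of §1 with `A` commutative:
`φ = [N] ≫ ψ` for a homomorphism `ψ : A → B`, unique among all morphisms with `[N] ≫ ψ = φ` (★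
`exists_isMonHom_pow_id_comp_eq_of_forall_pow_eq_one`: `[N]` is a flat surjective isogeny, an effective epimorphism of schemes).
This is the passage «`Λ(L)` restricts to `2λ₀` over `S₀` ⟹ `Λ(L) = 2λ` with `λ` lifting `λ₀`» of the infinitesimal lifting
of polarisations. [cite: MumfordFogartyKirwan1994, Ch. 6 §2 Prop. 6.11 (p. 122; proof pp. 122–123)] [cite: MumfordAV1970, §7 Thm. 4 (p. 72)]
[cite: SGA1, Exp. I Cor. 5.6 (p. 8)] -/
theorem exists_isMonHom_pow_id_comp_eq_of_isBaseChangeVia_of_surjective [IsCommMonObj A.X]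
    (hN : ∀ s : S, (N : S.residueField s) ≠ 0) (hG : A₀.IsBaseChangeVia A i G)
    (h₀ : ∀ ⦃T₀ : Over S₀⦄ (t₀ : T₀ ⟶ A₀.X), t₀ ^ N = 1 → hG.pushHom t₀ ≫ φ = 1) :
    ∃ ψ : A.X ⟶ B.X, IsMonHom ψ ∧ ((𝟙 A.X : A.X ⟶ A.X) ^ N) ≫ ψ = φ ∧
      ∀ ψ' : A.X ⟶ B.X, ((𝟙 A.X : A.X ⟶ A.X) ^ N) ≫ ψ' = φ → ψ' = ψ :=
  A.exists_isMonHom_pow_id_comp_eq_of_forall_pow_eq_one φ hN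
    (A.comp_eq_one_of_forall_pow_eq_one_of_isBaseChangeVia_of_surjective φ hN hG h₀)

end AbelianSchemeOver

end Literature.AlgebraicGeometry.AbelianSchemes

end
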